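import Mathlib
import Literature.NumberTheory.GaloisRepresentations.AbsGaloisOuterConj
import Literature.NumberTheory.GaloisRepresentations.SatakeFamilyOfFramedGaloisRep
import Literature.NumberTheory.GaloisRepresentations.HeckeCharacterGaloisAvatarProofs
import Literature.NumberTheory.GaloisRepresentations.HeckeCharacterOfRayClass
import Literature.NumberTheory.GaloisRepresentations.FramedRepTwist
import Literature.NumberTheory.GaloisRepresentations.ArtinRestriction
import Literature.NumberTheory.GaloisRepresentations.RestrictFieldSemisimple
import Literature.NumberTheory.GaloisRepresentations.FrobeniusPlaces
import Literature.NumberTheory.Automorphic.SelfdualGL3AdjointLiftProofs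
import Literature.NumberTheory.Automorphic.AutomorphicRepsGLSatakeFlathProofs
import Literature.NumberTheory.Automorphic.ChebotarevArtinRepHolds
import Literature.NumberTheory.Automorphic.ReciprocityGLnRestrictionProofs
import Summits.Langlands.Langlands.Theorems.TwistUnpackaging.Negative.TwistSeparationOrder

/-!
# The package dictionary — stub `stub_packageDictionary` of line kummer-chebotarev-separating-twists
(crux `TwistUnpackaging`, stmt-Langlands-10903)

Let `F/F₀` be a quadratic Galois extension of number fields with non-trivial automorphism `τ`,
`R : Γ_{F₀} → GL_{2n}(ℚ̄_ℓ)` the induced package of the controlled family attached to a rank-one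
avatar `eψ` (Frobenius value `c w` off `Q`): `R` is semisimple, and at every place `v ∤ ℓ` of
`F₀` all of whose primes `w ∣ v` are unramified over `F₀`, `π`-unramified (Satake parameter
`α w`) and `eψ`-unramified (value `cf w`), `R` is unramified with arithmetic-Frobenius
characteristic polynomial `∏ᶠ_{w ∣ v} P_w(X^{f(w|v)})`,
`P_w = arithFrobPolyOfSatake ι q_w n ((α w)·(cf w))`.

We prove the *dictionary* consumed by the cyclic unscrewing engine: `A := R|_{Γ_F}` is
semisimple (Clifford, `FramedGaloisRep.isSemisimple_restrictField`), its characteristic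
polynomials are invariant under the outer action `θ_t` of `Γ_{F₀}` on `Γ_F`
(`res (θ_t σ) = t · res σ · t⁻¹`, conjugate matrices), and at every good place `w` of `F`
(`v = w ∩ 𝓞 F₀`): `A` is unramified at `w` (`FramedGaloisRep.isUnramifiedAt_restrictField`) and
every arithmetic Frobenius `σ` at `w` has characteristic roots
`ι⁻¹(c w)⁻¹ • S_w + ι⁻¹(c (τ • w))⁻¹ • S_{τ • w}`, `S_w` the roots of
`arithFrobPolyOfSatake ι q_w n (αf w)` (an `n`-element multiset avoiding `0`).  The fibre of
`v` in `F` is `{w, τ • w}` (transitivity of `Gal(F/F₀) = {1, τ}`); in the split case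
`τ • w ≠ w` the fundamental identity gives `f = 1` and `A(σ) = R(Frob_v)` with characteristic
polynomial `P_w · P_{τ w}`; in the inert case `τ • w = w`, `f = 2`, `A(σ) = R(Frob_v)²` and
`charpoly R(Frob_v) = P_w(X²)`, whose roots squared are the roots of `P_w`, each twice
(`Matrix.roots_charpoly_pow` and `roots_expand_map_pow` below).

Sources: Neukirch, *Algebraic Number Theory*, Ch. I §9 (Frobenius under restriction, the
fundamental identity); Serre, *Abelian ℓ-adic representations*, Ch. I §2.1; Bourbaki, *Algèbre*,
Ch. VII §5 (roots of the characteristic polynomial of a power).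
-/

set_option linter.dupNamespace false -- project-wide option (lakefile weak.linter.dupNamespace); `Summit.Langlands.Langlands` is the mandated namespace

open Literature.NumberTheory.GaloisRepresentations Literature.NumberTheory.Automorphic
open IsDedekindDomain NumberField Filter
open scoped Polynomial

namespace Summit.Langlands.Langlands.Theorems.TwistUnpackaging.KummerChebotarev

/-- `s.bind (fun a ↦ replicate f a) = f • s` for a multiset `s`. [folklore] -/
theorem bind_replicate_eq_nsmul {α : Type*} (s : Multiset α) (f : ℕ) :
    s.bind (fun a ↦ Multiset.replicate f a) = f • s := by
  induction s using Multiset.induction_on with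
  | empty => simp
  | cons a s ih =>
    rw [Multiset.cons_bind, ih, ← Multiset.singleton_add, smul_add, Multiset.nsmul_singleton]

/-- **Roots of `P(X^f)` over an algebraically closed field**: the `f`-th powers of the roots of
`expand f P = P(X^f)`, counted with multiplicity, are the roots of `P`, each repeated `f` times
(`P = c ∏_r (X - r)`, `P(X^f) = c ∏_r (X^f - r)`, and `X^f - r` has exactly `f` roots, all with
`f`-th power `r`).  Bourbaki, *Algèbre*, Ch. V §4. [folklore] -/
theorem roots_expand_map_pow {k : Type*} [Field k] [IsAlgClosed k] (P : k[X]) {f : ℕ}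
    (hf : 0 < f) :
    ((Polynomial.expand k f P).roots).map (· ^ f) = f • P.roots := by
  rcases eq_or_ne P 0 with rfl | hP
  · simp
  have hlc : P.leadingCoeff ≠ 0 := Polynomial.leadingCoeff_ne_zero.mpr hP
  have hsplit :
      Polynomial.C P.leadingCoeff * (P.roots.map fun a ↦ Polynomial.X - Polynomial.C a).prod = P :=
    Polynomial.C_leadingCoeff_mul_prod_multiset_X_sub_C IsAlgClosed.card_roots_eq_natDegree
  have hexp : Polynomial.expand k f P = Polynomial.C P.leadingCoeff *
      (P.roots.map fun a ↦ (Polynomial.X : k[X]) ^ f - Polynomial.C a).prod := by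
    conv_lhs => rw [← hsplit]
    rw [map_mul, Polynomial.expand_C, map_multiset_prod, Multiset.map_map]
    congr 2
    refine Multiset.map_congr rfl fun a _ ↦ ?_
    simp only [Function.comp_apply, map_sub, Polynomial.expand_X, Polynomial.expand_C]
  have h0 : (0 : k[X]) ∉ P.roots.map fun a ↦ (Polynomial.X : k[X]) ^ f - Polynomial.C a := by
    rw [Multiset.mem_map]
    rintro ⟨a, -, ha⟩
    exact Polynomial.X_pow_sub_C_ne_zero hf a ha
  rw [hexp, Polynomial.roots_C_mul _ hlc, Polynomial.roots_multiset_prod _ h0, Multiset.bind_map,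
    Multiset.map_bind]
  have hnth : ∀ a : k, (((Polynomial.X : k[X]) ^ f - Polynomial.C a).roots).map (· ^ f) =
      Multiset.replicate f a := by
    intro a
    have hcard : Multiset.card ((Polynomial.X : k[X]) ^ f - Polynomial.C a).roots = f := by
      rw [IsAlgClosed.card_roots_eq_natDegree, Polynomial.natDegree_X_pow_sub_C]
    calc (((Polynomial.X : k[X]) ^ f - Polynomial.C a).roots).map (· ^ f)
        = (((Polynomial.X : k[X]) ^ f - Polynomial.C a).roots).map (fun _ ↦ a) :=
          Multiset.map_congr rfl fun x hx ↦ (Polynomial.mem_nthRoots hf).mp hx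
      _ = Multiset.replicate f a := by rw [Multiset.map_const', hcard]
  simp_rw [hnth]
  exact bind_replicate_eq_nsmul _ _

variable {ℓ : ℕ} [Fact ℓ.Prime] in
/-- **Twisting the Satake parameter scales the Frobenius roots**: the roots of
`arithFrobPolyOfSatake ι q m (α · c)` are the roots of `arithFrobPolyOfSatake ι q m α` multiplied
by `ι⁻¹(c)⁻¹` (`roots_arithFrobPolyOfSatake`: the roots are `ι⁻¹((√q^{m-1} a)⁻¹)`). [folklore] -/
theorem roots_arithFrobPolyOfSatake_map_mul (ι : PadicAlgCl ℓ ≃+* ℂ) (q m : ℕ) (α : Multiset ℂ)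
    (c : ℂ) :
    (arithFrobPolyOfSatake ι q m (α.map (fun a ↦ a * c))).roots =
      (arithFrobPolyOfSatake ι q m α).roots.map (fun x ↦ x * (ι.symm c)⁻¹) := by
  rw [roots_arithFrobPolyOfSatake, roots_arithFrobPolyOfSatake, Multiset.map_map, Multiset.map_map]
  refine Multiset.map_congr rfl fun a _ ↦ ?_
  simp only [Function.comp_apply]
  rw [← mul_assoc, mul_inv, map_mul, map_inv₀ ι.symm c]

variable {ℓ : ℕ} [Fact ℓ.Prime] in
/-- `arithFrobPolyOfSatake ι q m α ≠ 0` (it is a product of monic linear factors, hence monic;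
cf. `monic_arithFrobPolyOfSatake` of the sibling file `QuadraticWindowTwistUnpackagingAssembly`).
[folklore] -/
theorem arithFrobPolyOfSatake_ne_zero (ι : PadicAlgCl ℓ ≃+* ℂ) (q m : ℕ) (α : Multiset ℂ) :
    arithFrobPolyOfSatake ι q m α ≠ 0 := by
  refine Polynomial.Monic.ne_zero ?_
  unfold arithFrobPolyOfSatake
  exact Polynomial.monic_multiset_prod_of_monic _ _ fun a _ ↦ Polynomial.monic_X_sub_C _

variable {ℓ : ℕ} [Fact ℓ.Prime] in
/-- The roots of `arithFrobPolyOfSatake ι q m α` avoid `0` when `q > 0` and `0 ∉ α`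
(`roots_arithFrobPolyOfSatake`, `√q ≠ 0`). [folklore] -/
theorem zero_not_mem_roots_arithFrobPolyOfSatake' (ι : PadicAlgCl ℓ ≃+* ℂ) {q : ℕ} (hq : 0 < q)
    (m : ℕ) {α : Multiset ℂ} (hα : ∀ a ∈ α, a ≠ 0) :
    (0 : PadicAlgCl ℓ) ∉ (arithFrobPolyOfSatake ι q m α).roots := by
  rw [roots_arithFrobPolyOfSatake, Multiset.mem_map]
  rintro ⟨a, ha, h0⟩
  rw [map_eq_zero, inv_eq_zero, mul_eq_zero] at h0
  rcases h0 with h0 | h0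
  · exact sqrt_pow_ne_zero hq m h0
  · exact hα a ha h0

/-- **Stub C — the package dictionary.**  `F/F₀` quadratic Galois with `Gal(F/F₀) = {1, τ}`;
`R : Γ_{F₀} → GL_{2n}(ℚ̄_ℓ)` the (semisimple) induced package of the controlled family of the
avatar `eψ` (Frobenius value `c w` at `w ∉ Q`), whose controlled clause — at `v ∤ ℓ` with all
`w ∣ v` unramified over `F₀`, `π`-unramified and `eψ`-unramified, `R` is unramified at `v` with
arithmetic-Frobenius characteristic polynomial `∏ᶠ_{w ∣ v} P_w(X^{f(w|v)})`,
`P_w = arithFrobPolyOfSatake ι q_w n ((α w) · cf w)` — is the third hypothesis verbatim.  Then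
`A := R|_{Γ_F}` is semisimple (`FramedGaloisRep.isSemisimple_restrictField`, Clifford),
`charpoly A (θ_t g) = charpoly A g` (`res (θ_t g) = t res(g) t⁻¹`, conjugate matrices), and at
every good place `w` (`ℓ ∉ w ∩ 𝓞 F₀`; `e = 1` and `π` unramified above `w ∩ 𝓞 F₀`;
`w, τ • w ∉ Q`): `A` is unramified at `w` (`FramedGaloisRep.isUnramifiedAt_restrictField`), the
multiset `S_w` of roots of `arithFrobPolyOfSatake ι q_w n (αf w)` has `n` non-zero elements
(`HasSatakeParamAt.card_eq`, `hasSatakeParamAt_ne_zero_holds`), and every arithmetic Frobenius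
`σ` at `w` has `roots (charpoly A σ) = ι⁻¹(c w)⁻¹ • S_w + ι⁻¹(c (τ • w))⁻¹ • S_{τ • w}`:
the fibre of `v = w ∩ 𝓞 F₀` is `{w, τ • w}` (`HeightOneSpectrum.exists_algEquiv_smul_eq`),
`A σ = R(φ)^{f(w|v)}` for a Frobenius `φ` at `v`
(`FramedGaloisRep.exists_restrictField_apply_eq_pow`);
split case `f = 1` (fundamental identity `#{w ∣ v} · f = 2`,
`natCard_placesOver_mul_inertiaDeg`), `charpoly = P_w P_{τ w}`; inert case `f = 2`,
`charpoly R(φ) = P_w(X²)` and the squares of its roots are the roots of `P_w` twice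
(`Matrix.roots_charpoly_pow`, `roots_expand_map_pow`).  Neukirch, *Algebraic Number Theory*,
Ch. I §9; Serre, *Abelian ℓ-adic representations*, Ch. I §2.1. -/
theorem stub_packageDictionary :
    ∀ (F₀ F : Type) [Field F₀] [NumberField F₀] [Field F] [NumberField F] [Algebra F₀ F]
      [IsGalois F₀ F] (τ : F ≃ₐ[F₀] F), Module.finrank F₀ F = 2 → τ ≠ 1 →
    ∀ (n : ℕ) (hcpt : isCompact_glFiniteIntegralLevel n F) (π : CuspidalAutomorphicRepData n F hcpt)
      (ℓ : ℕ) [Fact ℓ.Prime] (ι : PadicAlgCl ℓ ≃+* ℂ)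
      (eψ : FramedGaloisRep F ℂ 1) (c : HeightOneSpectrum (𝓞 F) → ℂ)
      (Q : Set (HeightOneSpectrum (𝓞 F))) (αf : HeightOneSpectrum (𝓞 F) → Multiset ℂ)
      (R : FramedGaloisRep F₀ (PadicAlgCl ℓ) (2 * n)),
      (∀ v ∉ Q, eψ.IsUnramifiedAt v ∧ eψ.HasFrobCharpolyAt v (Polynomial.X - Polynomial.C (c v))) →
      R.toGaloisRep.IsSemisimple →
      (∀ (v : HeightOneSpectrum (𝓞 F₀)) (α : HeightOneSpectrum (𝓞 F) → Multiset ℂ)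
          (cf : HeightOneSpectrum (𝓞 F) → ℂ), ((ℓ : ℕ) : 𝓞 F₀) ∉ v.asIdeal →
        (∀ w : HeightOneSpectrum (𝓞 F), w.under (𝓞 F₀) = v →
          w.asIdeal.ramificationIdx (𝓞 F₀) = 1 ∧ π.1.HasSatakeParamAt w (α w) ∧
          eψ.IsUnramifiedAt w ∧ eψ.HasFrobCharpolyAt w (Polynomial.X - Polynomial.C (cf w))) →
        R.IsUnramifiedAt v ∧ R.HasFrobCharpolyAt v
          (∏ᶠ w ∈ {w : HeightOneSpectrum (𝓞 F) | w.under (𝓞 F₀) = v},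
            Polynomial.expand (PadicAlgCl ℓ) (w.asIdeal.inertiaDeg (𝓞 F₀))
              (arithFrobPolyOfSatake ι w.residueCard n ((α w).map (fun a ↦ a * cf w))))) →
    (R.restrictField F).toGaloisRep.IsSemisimple ∧
    (∀ (t : Field.absoluteGaloisGroup F₀) (g : Field.absoluteGaloisGroup F),
        FramedRep.charpoly (R.restrictField F) (absGaloisOuterConj F₀ F t g) =
          FramedRep.charpoly (R.restrictField F) g) ∧
    ∀ w : HeightOneSpectrum (𝓞 F),
      ((ℓ : ℕ) : 𝓞 F₀) ∉ (w.under (𝓞 F₀)).asIdeal →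
      (∀ w' : HeightOneSpectrum (𝓞 F), w'.under (𝓞 F₀) = w.under (𝓞 F₀) →
          w'.asIdeal.ramificationIdx (𝓞 F₀) = 1 ∧ π.1.HasSatakeParamAt w' (αf w')) →
      w ∉ Q → τ • w ∉ Q →
      (R.restrictField F).IsUnramifiedAt w ∧
      Multiset.card (arithFrobPolyOfSatake ι w.residueCard n (αf w)).roots = n ∧
      (0 : PadicAlgCl ℓ) ∉ (arithFrobPolyOfSatake ι w.residueCard n (αf w)).roots ∧
      ∀ 𝔓 ∈ w.primesAbove, ∀ σ : Field.absoluteGaloisGroup F, IsArithFrobAt (𝓞 F) σ 𝔓 →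
        (FramedRep.charpoly (R.restrictField F) σ).roots =
          (arithFrobPolyOfSatake ι w.residueCard n (αf w)).roots.map
              (fun x ↦ x * (ι.symm (c w))⁻¹) +
          (arithFrobPolyOfSatake ι (τ • w).residueCard n (αf (τ • w))).roots.map
              (fun x ↦ x * (ι.symm (c (τ • w)))⁻¹) := by
  intro F₀ F _ _ _ _ _ _ τ hdeg hτ n hcpt π ℓ _ ι eψ c Q αf R heψ hss hfam
  classical
  /- 1. `Gal(F/F₀) = {1, τ}`. -/
  haveI : FiniteDimensional F₀ F := Module.finite_of_finrank_eq_succ hdeg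
  have hcard : Fintype.card (F ≃ₐ[F₀] F) = 2 := by
    apply le_antisymm (hdeg ▸ AlgEquiv.card_le)
    haveI : Nontrivial (F ≃ₐ[F₀] F) := ⟨⟨τ, 1, hτ⟩⟩
    exact Fintype.one_lt_card
  have hGal : ∀ σ : F ≃ₐ[F₀] F, σ = 1 ∨ σ = τ := by
    have huniv : ({1, τ} : Finset (F ≃ₐ[F₀] F)) = Finset.univ :=
      Finset.eq_univ_of_card _ (by rw [Finset.card_pair (Ne.symm hτ), hcard])
    intro σ
    have hσ := Finset.mem_univ σ
    rw [← huniv, Finset.mem_insert, Finset.mem_singleton] at hσ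
    exact hσ
  refine ⟨FramedGaloisRep.isSemisimple_restrictField R hss, fun t g ↦ ?_,
    fun w hℓ hgood hwQ hτwQ ↦ ?_⟩
  · /- 2. `θ_t`-invariance of the characteristic polynomials of `A = R|_{Γ_F}`. -/
    unfold FramedRep.charpoly
    rw [FramedGaloisRep.restrictField_apply, FramedGaloisRep.restrictField_apply,
      absGaloisRestrict_absGaloisOuterConj, map_mul, map_mul, map_inv, Units.val_mul,
      Units.val_mul, Matrix.coe_units_inv, Matrix.charpoly_units_conj]
  · /- 3. A good place `w` of `F`, `v = w ∩ 𝓞 F₀`. -/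
    set v : HeightOneSpectrum (𝓞 F₀) := w.under (𝓞 F₀) with hv
    have hw : w.asIdeal.under (𝓞 F₀) = v.asIdeal := rfl
    have hwv : w.under (𝓞 F₀) = v := rfl
    have hτwv : (τ • w).under (𝓞 F₀) = v := by
      rw [HeightOneSpectrum.under_algEquiv_smul]
    -- the fibre of `v` is `{w, τ • w}`
    have hfib : ∀ w' : HeightOneSpectrum (𝓞 F), w'.under (𝓞 F₀) = v ↔ (w' = w ∨ w' = τ • w) := by
      intro w'
      constructor
      · intro h
        obtain ⟨σ, rfl⟩ :=
          HeightOneSpectrum.exists_algEquiv_smul_eq (F := F₀) (w := w) (w' := w') (hwv.trans h.symm)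
        rcases hGal σ with rfl | rfl
        · exact Or.inl (one_smul _ _)
        · exact Or.inr rfl
      · rintro (rfl | rfl)
        exacts [hwv, hτwv]
    have hS : {w' : HeightOneSpectrum (𝓞 F) | w'.under (𝓞 F₀) = v} = {w, τ • w} := by
      ext w'
      simp only [Set.mem_setOf_eq, Set.mem_insert_iff, Set.mem_singleton_iff]
      exact hfib w'
    -- the controlled clause of the family at `v`
    have hprem : ∀ w' : HeightOneSpectrum (𝓞 F), w'.under (𝓞 F₀) = v →
        w'.asIdeal.ramificationIdx (𝓞 F₀) = 1 ∧ π.1.HasSatakeParamAt w' (αf w') ∧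
        eψ.IsUnramifiedAt w' ∧ eψ.HasFrobCharpolyAt w' (Polynomial.X - Polynomial.C (c w')) := by
      intro w' hw'
      have hw'Q : w' ∉ Q := by
        rcases (hfib w').mp hw' with rfl | rfl
        exacts [hwQ, hτwQ]
      exact ⟨(hgood w' hw').1, (hgood w' hw').2, (heψ w' hw'Q).1, (heψ w' hw'Q).2⟩
    obtain ⟨hRv, hRP⟩ := hfam v αf c hℓ hprem
    have hSat : π.1.HasSatakeParamAt w (αf w) := (hgood w hwv).2
    have hq : 0 < w.residueCard := lt_trans zero_lt_one (HeightOneSpectrum.one_lt_residueCard w)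
    refine ⟨R.isUnramifiedAt_restrictField hw hRv, ?_, ?_, fun 𝔓 h𝔓 σ hσ ↦ ?_⟩
    · rw [roots_arithFrobPolyOfSatake, Multiset.card_map]
      exact hSat.card_eq
    · exact zero_not_mem_roots_arithFrobPolyOfSatake' ι hq n (hasSatakeParamAt_ne_zero_holds hSat)
    /- 4. Roots of `charpoly A(σ)` for an arithmetic Frobenius `σ` at `𝔓 ∣ w`. -/
    obtain ⟨𝔓₀, h𝔓₀, φ, hφ, heq⟩ := R.exists_restrictField_apply_eq_pow hw hRv h𝔓 hσ
    have hch := hRP 𝔓₀ h𝔓₀ φ hφ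
    -- `v` is unramified in `F`, so `#{w' ∣ v} · f(w|v) = [F : F₀] = 2`
    have hunr : Algebra.IsUnramifiedIn (𝓞 F) v.asIdeal := by
      intro P hP hPv
      haveI := hP
      haveI := hPv
      have hPne : P ≠ ⊥ := Ideal.ne_bot_of_liesOver_of_ne_bot v.ne_bot P
      have he := (hgood ⟨P, hP, hPne⟩ (HeightOneSpectrum.ext hPv.over.symm)).1
      exact Ideal.ramificationIdx_eq_one_iff.mp he
    have hfund := natCard_placesOver_mul_inertiaDeg hunr hwv
    have hNat : Nat.card {w' : HeightOneSpectrum (𝓞 F) // w'.under (𝓞 F₀) = v} =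
        ({w, τ • w} : Set (HeightOneSpectrum (𝓞 F))).ncard := by
      rw [← hS, ← Nat.card_coe_set_eq]
      rfl
    rw [hdeg, hNat] at hfund
    have hne : ∀ w' : HeightOneSpectrum (𝓞 F),
        arithFrobPolyOfSatake ι w'.residueCard n ((αf w').map (fun a ↦ a * c w')) ≠ 0 :=
      fun w' ↦ arithFrobPolyOfSatake_ne_zero ι _ _ _
    by_cases hτw : τ • w = w
    · /- inert: `τ • w = w`, `f = 2`, `A σ = R(φ)²`, `charpoly R(φ) = P_w(X²)` -/
      rw [hτw, Set.pair_eq_singleton, Set.ncard_singleton, one_mul] at hfund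
      rw [hS, hτw, Set.pair_eq_singleton, finprod_mem_singleton, hfund] at hch
      rw [hfund] at heq
      unfold FramedRep.charpoly at hch ⊢
      rw [heq, Units.val_pow_eq_pow_val, Matrix.roots_charpoly_pow, hch,
        roots_expand_map_pow _ two_pos, two_nsmul, roots_arithFrobPolyOfSatake_map_mul, hτw]
    · /- split: `{w' ∣ v} = {w, τ • w}` has two elements, `f = 1`, `A σ = R(φ)`,
         `charpoly R(φ) = P_w · P_{τ • w}` -/
      rw [Set.ncard_pair (Ne.symm hτw)] at hfund
      have hf1 : w.asIdeal.inertiaDeg (𝓞 F₀) = 1 := by omega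
      rw [hf1, pow_one] at heq
      rw [hS, finprod_mem_pair (Ne.symm hτw), HeightOneSpectrum.inertiaDeg_algEquiv_smul, hf1,
        Polynomial.expand_one, Polynomial.expand_one] at hch
      unfold FramedRep.charpoly at hch ⊢
      rw [heq, hch, Polynomial.roots_mul (mul_ne_zero (hne w) (hne (τ • w))),
        roots_arithFrobPolyOfSatake_map_mul, roots_arithFrobPolyOfSatake_map_mul]

end Summit.Langlands.Langlands.Theorems.TwistUnpackaging.KummerChebotarev
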